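import Literature.AlgebraicGeometry.ComplexMultiplication.CyclotomicFermatCMTypesBadOddCharacterCountExact
import HarnessLib

/-!
# Koblitz–Rohrlich's REMARK 1 "`3/20` is the maximum for `s(N)`", at prime-power and two-prime levels: `s(N) ≤ 3/20 = s(55)`, with
# equality only at `N = 55`

Layer `Literature/AlgebraicGeometry/ComplexMultiplication`, namespace `…ComplexMultiplication.CyclotomicFermatCMType`; sequel of
`CyclotomicFermatCMTypesBadOddCharacterCountExact` (exact counts; `#S₀(55) = 3`, `#S(55) = 20`) and `CyclotomicFermatCMTypesTwoPrimeLevelSimple`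
(the sides `A(m; qᵇ)`, K–R's "Case 1. `m = 2`" for the bound `1/6`).  THEOREMS ONLY (no definition, no named fact, no `sorry`).

THE SOURCE.  N. Koblitz, D. Rohrlich, *Simple factors in the Jacobian of a Fermat curve*, Canad. J. Math. **30** (1978) 1183–1205, §2.
"Case 1. `m = 2`, `s(N) = 1/((p₁ − 1)ord₁) + 1/((p₂ − 1)ord₂)`.  By Table 1, if `p₁ = 5` or `7`, then `ord₁ ≥ 3` with equality only if `p₂ = 31` or
`19`.  If `p₁ ≥ 11`, then `(p₁ − 1)ord₁ ≥ 20` by (1).  Thus in either case `s(N) ≤ 1/((5 − 1)·3) + 1/((p₂ − 1)·3)` if `p₂ ≥ 13` (with at least one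
`≤` strict).  For the remaining case `p₁ = 5`, `p₂ = 11`: `s(55) = 1/4·5 + 1/10 = 3/20 < 1/6`" (p. 1191) and REMARK 1 (p. 1192): "When `N = 55`,
`#S(N) = ½φ(N) = 20`, and `#S₀(N) = 3` … Thus, `s(55) = 3/20`.  **It is clear from the above proof that `3/20` is the maximum for `s(N)`.**"

THIS FILE proves the maximum claim at the levels with at most two prime factors (`N` prime to `6`): §1 prime powers (`#S₀ = 0`); §2 the
arithmetic **`40·(A(p; qᵇ) + A(q; pᵃ)) < 3·φ(pᵃ)φ(qᵇ)` unless `(pᵃ, qᵇ) = (5, 11)`** (our re-run of Case `m = 2` with the constant `3/20` in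
place of `1/6`: `q = 7` both sides vanish; otherwise `2B ≤ Φ₁`, `A = 0` or `2dA = Φ₂` with `d` odd `≥ 3`; `Φ₁ ≥ 8` generic; `Φ₁ = 6`: `q^b = 11`
killed by `7⁵ ≡ −1 (11)`, else `Φ₂ ≥ 12`; `Φ₁ = 4`: `d ≥ 5` gives `40A ≤ 4Φ₂` and equality forces `Φ₂ = 10`, `d = 3` forces `qᵇ = 31`); §3
**`40·#S₀(N) ≤ 3·φ(N)` at every two-prime level `N = pᵃqᵇ` (`p ≠ q` primes `≥ 5`), i.e. `s(N) ≤ 3/20`, with `<` iff `N ≠ 55`** (the equality at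
`55` is the sibling's `#S₀(55) = 3`); §4 the printed form **`s(N) ≤ s(55)`** as rational numbers.

## Honest column / NOT here

* Levels with three or more prime factors (K–R's Cases 2–5 re-run with `3/20`) are NOT typed; numerically (this session) the structural bound
  `40·Σ_p A(p; N_p) < 3φ(N)` holds at every `N < 40000` prime to `6` other than `55` and the prime powers (where both sides' left term is `0`).
  "`lim s(N) = 0`" is NOT typed.
* `s(N)` is written as `#S₀(N)/#S(N)` in `ℚ` (`Nat.card` of subtypes of `DirichletCharacter ℂ N`), as in the sibling.
* Private: `orderOf_unitOfCoprime_eq_one_iff''`, `dvd_pow_orderOf_sub_one''`, `prime_ge_five_cases'`, `card_level_congr''` (copies of the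
  siblings'), the `decide` facts `seven_pow_five_mod_eleven`, `five_seven_facts`.

## References

* [KoblitzRohrlich1978] N. Koblitz, D. Rohrlich, Canad. J. Math. 30 (1978) 1183–1205: §2 Proposition, Case 1 (p. 1191), Remark 1 (p. 1192),
  Table 1 (p. 1190: `5³ − 1 = 4·31`).
* [Washington1997] L. C. Washington, *Introduction to Cyclotomic Fields*, Cor. 4.4 (through the siblings).

## Provenance

Cell `pub-hodgecm2` (COR-CM), literature seat `lit-deligne-3` gen 35 (claim KR78-MAXIMUM; count-neutral, own lane).
-/

noncomputable section

open NumberField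

namespace Literature.AlgebraicGeometry.ComplexMultiplication

open Literature.NumberTheory.ComplexMultiplication
open Literature.NumberTheory.LFunctions

namespace CyclotomicFermatCMType

/-! ## §1 Prime-power levels: `S₀ = ∅`, so `s(pⁿ) = 0` -/

section PrimePower

variable {p : ℕ} [hp : Fact p.Prime] {n : ℕ}

/-- **`#S₀(pⁿ) = 0`**: at prime-power level every odd character is good (the sibling's `bernoulliOneChar_ne_zero_of_odd_primePow`), so
`s(pⁿ) = 0 ≤ 3/20`. [cite: KoblitzRohrlich1978, §2 (p. 1188) and Remark 1 (p. 1192)] -/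
theorem card_bad_primePow_eq_zero [NeZero (p ^ n)] :
    Nat.card {χ : DirichletCharacter ℂ (p ^ n) // χ.Odd ∧ bernoulliOneChar χ = 0} = 0 := by
  rw [Nat.card_eq_zero]
  exact Or.inl ⟨fun ⟨χ, hodd, h0⟩ => bernoulliOneChar_ne_zero_of_odd_primePow hodd h0⟩

end PrimePower

/-! ## §2 The arithmetic of Case `m = 2` with the constant `3/20`: `40·(A + B) < 3·Φ₁Φ₂` unless `(pᵃ, qᵇ) = (5, 11)` -/

section Arithmetic

variable {M : ℕ}

/-- The order of `m` modulo `M` is `1` iff `m ≡ 1 (mod M)` (private copy of the siblings'). [folklore] -/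
private theorem orderOf_unitOfCoprime_eq_one_iff'' {m : ℕ} (hm : m.Coprime M) :
    orderOf (ZMod.unitOfCoprime m hm) = 1 ↔ (m : ZMod M) = 1 := by
  rw [orderOf_eq_one_iff, ← ZMod.coe_unitOfCoprime m hm]
  exact ⟨fun h => by rw [h, Units.val_one], fun h => Units.ext (h.trans Units.val_one.symm)⟩

/-- `M ∣ mᵈ − 1` for `d` the order of `m` modulo `M` (`m ≥ 1`; private copy of the siblings'). [folklore] -/
private theorem dvd_pow_orderOf_sub_one'' {m : ℕ} (hm : m.Coprime M) (hm1 : 1 ≤ m) :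
    M ∣ m ^ orderOf (ZMod.unitOfCoprime m hm) - 1 := by
  have hu : ((m : ZMod M)) ^ orderOf (ZMod.unitOfCoprime m hm) = 1 := by
    rw [← ZMod.coe_unitOfCoprime m hm, ← Units.val_pow_eq_pow_val, pow_orderOf_eq_one, Units.val_one]
  have h1 : 1 ≤ m ^ orderOf (ZMod.unitOfCoprime m hm) := Nat.one_le_pow _ _ hm1
  have h : ((m ^ orderOf (ZMod.unitOfCoprime m hm) - 1 : ℕ) : ZMod M) = 0 := by
    rw [Nat.cast_sub h1, Nat.cast_pow, Nat.cast_one, hu, sub_self]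
  exact (ZMod.natCast_eq_zero_iff _ _).1 h

/-- `7⁵ ≡ −1 (mod 11)` (kernel computation): `7` is "a root of `−1`" modulo `11`. [folklore] -/
private theorem seven_pow_five_mod_eleven : ((7 : ℕ) : ZMod 11) ^ 5 = -1 := by decide

/-- `5³ ≡ −1 (mod 7)` and `7² ≡ −1 (mod 5)` (kernel computation). [folklore] -/
private theorem five_seven_facts : ((5 : ℕ) : ZMod 7) ^ 3 = -1 ∧ ((7 : ℕ) : ZMod 5) ^ 2 = -1 := by decide

/-- The primes `≥ 5` below `11` are `5` and `7` (private copy of the sibling's). [folklore] -/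
private theorem prime_ge_five_cases' {r : ℕ} (hr : r.Prime) (h5 : 5 ≤ r) : r = 5 ∨ r = 7 ∨ 11 ≤ r := by
  by_cases h11 : 11 ≤ r
  · exact Or.inr (Or.inr h11)
  · interval_cases r
    · exact Or.inl rfl
    · exact absurd hr (by decide)
    · exact Or.inr (Or.inl rfl)
    · exact absurd hr (by decide)
    · exact absurd hr (by decide)
    · exact absurd hr (by decide)

/-- **Case `m = 2` with the constant `3/20`, ordered form**: for primes `5 ≤ p < q` and `a, b ≥ 1`, with `A = #{ψ mod qᵇ odd : ψ(p) = 1}`,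
`B = #{ψ mod pᵃ odd : ψ(q) = 1}`: `40·(A + B) < 3·φ(pᵃ)φ(qᵇ)`, unless `pᵃ = 5` and `qᵇ = 11` ("with at least one `≤` strict … For the remaining
case `p₁ = 5`, `p₂ = 11`: `s(55) = … = 3/20`"). [cite: KoblitzRohrlich1978, §2 Proposition, Case 1 (p. 1191) and Remark 1 (p. 1192)] -/
theorem forty_mul_card_sides_lt_or_of_lt {p q a b : ℕ} [hp : Fact p.Prime] [hq : Fact q.Prime] (hp5 : 5 ≤ p) (hpq : p < q)
    (ha : a ≠ 0) (hb : b ≠ 0) :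
    40 * (Nat.card {ψ : DirichletCharacter ℂ (q ^ b) // ψ.Odd ∧ ψ (p : ZMod (q ^ b)) = 1} +
        Nat.card {ψ : DirichletCharacter ℂ (p ^ a) // ψ.Odd ∧ ψ (q : ZMod (p ^ a)) = 1}) <
      3 * ((p ^ a).totient * (q ^ b).totient) ∨ (p = 5 ∧ a = 1 ∧ q ^ b = 11) := by
  haveI : NeZero (q ^ b) := ⟨pow_ne_zero b hq.out.ne_zero⟩
  haveI : NeZero (p ^ a) := ⟨pow_ne_zero a hp.out.ne_zero⟩
  have hp2 : p ≠ 2 := by omega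
  have hq2 : q ≠ 2 := by omega
  have hpq' : p ≠ q := hpq.ne
  have copr1 : p.Coprime (q ^ b) := ((Nat.coprime_primes hp.out hq.out).2 hpq').pow_right b
  have copr2 : q.Coprime (p ^ a) := ((Nat.coprime_primes hq.out hp.out).2 hpq'.symm).pow_right a
  set A := Nat.card {ψ : DirichletCharacter ℂ (q ^ b) // ψ.Odd ∧ ψ (p : ZMod (q ^ b)) = 1} with hA
  set B := Nat.card {ψ : DirichletCharacter ℂ (p ^ a) // ψ.Odd ∧ ψ (q : ZMod (p ^ a)) = 1} with hB
  -- the totients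
  have hΦ₁ : (p ^ a).totient = p ^ (a - 1) * (p - 1) := Nat.totient_prime_pow hp.out (Nat.pos_of_ne_zero ha)
  have hΦ₂ : (q ^ b).totient = q ^ (b - 1) * (q - 1) := Nat.totient_prime_pow hq.out (Nat.pos_of_ne_zero hb)
  have hpa : 1 ≤ p ^ (a - 1) := Nat.one_le_pow _ _ hp.out.pos
  have hqb : 1 ≤ q ^ (b - 1) := Nat.one_le_pow _ _ hq.out.pos
  have hΦ₁ge : p - 1 ≤ (p ^ a).totient := by
    rw [hΦ₁]
    calc p - 1 = 1 * (p - 1) := (one_mul _).symm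
      _ ≤ p ^ (a - 1) * (p - 1) := Nat.mul_le_mul_right _ hpa
  have hΦ₂ge : q - 1 ≤ (q ^ b).totient := by
    rw [hΦ₂]
    calc q - 1 = 1 * (q - 1) := (one_mul _).symm
      _ ≤ q ^ (b - 1) * (q - 1) := Nat.mul_le_mul_right _ hqb
  -- `a ≥ 2 ⟹ Φ₁ ≥ p(p − 1) ≥ 20`; `b ≥ 2 ⟹ Φ₂ ≥ q(q − 1)`
  have hΦ₁ge' : 2 ≤ a → p * (p - 1) ≤ (p ^ a).totient := fun ha2 => by
    rw [hΦ₁]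
    refine Nat.mul_le_mul_right _ ?_
    calc p = p ^ 1 := (pow_one p).symm
      _ ≤ p ^ (a - 1) := Nat.pow_le_pow_right hp.out.pos (by omega)
  have hΦ₂ge' : 2 ≤ b → q * (q - 1) ≤ (q ^ b).totient := fun hb2 => by
    rw [hΦ₂]
    refine Nat.mul_le_mul_right _ ?_
    calc q = q ^ 1 := (pow_one q).symm
      _ ≤ q ^ (b - 1) := Nat.pow_le_pow_right hq.out.pos (by omega)
  have hB2 : 2 * B ≤ (p ^ a).totient := two_mul_card_side_le hp2 ha copr2
  -- `q = 7` forces `p = 5`: both sides vanish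
  rcases prime_ge_five_cases' hq.out (by omega) with hq5 | hq7 | hq11
  · omega
  · left
    have hp5' : p = 5 := by
      rcases prime_ge_five_cases' hp.out hp5 with h | h | h
      · exact h
      · omega
      · omega
    subst hq7
    subst hp5'
    have hA0 : A = 0 := card_side_eq_zero_of_pow_natCast_eq_neg_one hq2 hb copr1 five_seven_facts.1
    have hB0 : B = 0 := card_side_eq_zero_of_pow_natCast_eq_neg_one hp2 ha copr2 five_seven_facts.2
    rw [hA0, hB0]
    exact Nat.mul_pos (by norm_num) (Nat.mul_pos (Nat.totient_pos.2 (NeZero.pos _)) (Nat.totient_pos.2 (NeZero.pos _)))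
  -- `q ≥ 11`: `Φ₂ ≥ 10`, `Φ₁ ≥ 4`
  have hΦ₂10 : 10 ≤ (q ^ b).totient := le_trans (by omega) hΦ₂ge
  have hΦ₁4 : 4 ≤ (p ^ a).totient := le_trans (by omega) hΦ₁ge
  -- the `A`-dichotomy: `A = 0`, or `d` odd with `2dA = Φ₂`, `d ≠ 1`
  have hd1 : orderOf (ZMod.unitOfCoprime p copr1) ≠ 1 := by
    rw [Ne, orderOf_unitOfCoprime_eq_one_iff'' copr1]
    intro h1
    have hlt : p < q ^ b := lt_of_lt_of_le hpq (by
      calc q = q ^ 1 := (pow_one q).symm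
        _ ≤ q ^ b := Nat.pow_le_pow_right hq.out.pos (Nat.one_le_iff_ne_zero.2 hb))
    have h2 := (ZMod.natCast_eq_natCast_iff' p 1 (q ^ b)).1 (by rw [Nat.cast_one]; exact h1)
    rw [Nat.mod_eq_of_lt hlt, Nat.mod_eq_of_lt (lt_trans (by omega) hlt)] at h2
    omega
  -- `6A ≤ Φ₂` always
  have h6A : 6 * A ≤ (q ^ b).totient := by
    rcases card_side_dichotomy hq2 hb copr1 with hA0 | ⟨hodd, hdA⟩
    · rw [← hA] at hA0
      rw [hA0, mul_zero]
      exact Nat.zero_le _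
    · rw [← hA] at hdA
      have hd3 : 3 ≤ orderOf (ZMod.unitOfCoprime p copr1) := by
        obtain ⟨k, hk⟩ := hodd
        omega
      rw [← hdA]
      calc 6 * A = 2 * 3 * A := by ring
        _ ≤ 2 * orderOf (ZMod.unitOfCoprime p copr1) * A := Nat.mul_le_mul_right _ (Nat.mul_le_mul_left 2 hd3)
  -- `Φ₁ ≥ 8`: generic
  by_cases hΦ₁8 : 8 ≤ (p ^ a).totient
  · left
    nlinarith
  -- `Φ₁ < 8` forces `a = 1` and `p ∈ {5, 7}`
  have ha1 : a = 1 := by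
    by_contra ha1
    have h20 := hΦ₁ge' (by omega)
    have : 20 ≤ p * (p - 1) := by
      calc 20 = 5 * (5 - 1) := by norm_num
        _ ≤ p * (p - 1) := Nat.mul_le_mul hp5 (by omega)
    omega
  subst ha1
  rw [pow_one] at hΦ₁ hB2 hΦ₁8 hΦ₁4 ⊢
  rcases prime_ge_five_cases' hp.out hp5 with rfl | rfl | hp11
  · -- `p = 5`: `Φ₁ = 4`, `B ≤ 2`
    have hΦ₁' : Nat.totient 5 = 4 := Nat.totient_prime (by norm_num)
    rw [hΦ₁'] at hB2 ⊢
    rcases card_side_dichotomy hq2 hb copr1 with hA0 | ⟨hodd, hdA⟩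
    · left
      rw [← hA] at hA0
      rw [hA0]
      omega
    · rw [← hA] at hdA
      by_cases hd3 : orderOf (ZMod.unitOfCoprime 5 copr1) = 3
      · -- `d = 3`: `qᵇ ∣ 124`, so `q = 31`, `Φ₂ ≥ 30`, `6A = Φ₂`
        left
        have hdvd : q ^ b ∣ 124 := by
          have h := dvd_pow_orderOf_sub_one'' copr1 (by norm_num)
          rw [hd3] at h
          norm_num at h
          exact h
        have hq31 : q = 31 := by
          have hqd : q ∣ 4 * 31 := dvd_trans (dvd_pow_self q hb) hdvd
          rcases (Nat.Prime.dvd_mul hq.out).1 hqd with h4 | h31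
          · exfalso
            have := Nat.le_of_dvd (by norm_num) h4
            omega
          · exact (Nat.prime_dvd_prime_iff_eq hq.out (by norm_num)).1 h31
        subst hq31
        have h30 : 30 ≤ (31 ^ b).totient := le_trans (by norm_num) hΦ₂ge
        rw [hd3] at hdA
        omega
      · -- `d ≥ 5`: `10A ≤ Φ₂`; equality only for `Φ₂ = 10`, i.e. `qᵇ = 11`
        have hd5 : 5 ≤ orderOf (ZMod.unitOfCoprime 5 copr1) := by
          obtain ⟨k, hk⟩ := hodd
          omega
        have h10A : 10 * A ≤ (q ^ b).totient := by
          rw [← hdA]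
          calc 10 * A = 2 * 5 * A := by ring
            _ ≤ 2 * orderOf (ZMod.unitOfCoprime 5 copr1) * A := Nat.mul_le_mul_right _ (Nat.mul_le_mul_left 2 hd5)
        by_cases hΦ₂10' : (q ^ b).totient = 10
        · -- `Φ₂ = 10` forces `q = 11`, `b = 1`
          right
          refine ⟨rfl, rfl, ?_⟩
          rcases Nat.lt_or_ge b 2 with hb1 | hb2
          · have hb1' : b = 1 := by omega
            subst hb1'
            rw [pow_one] at hΦ₂10' ⊢
            -- `φ(q) = 10`, `q` prime `⟹ q = 11`
            rw [Nat.totient_prime hq.out] at hΦ₂10'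
            omega
          · exfalso
            have h := hΦ₂ge' hb2
            rw [hΦ₂10'] at h
            have : 11 * (11 - 1) ≤ q * (q - 1) := Nat.mul_le_mul hq11 (by omega)
            omega
        · left
          omega
  · -- `p = 7`: `Φ₁ = 6`, `B ≤ 3`
    have hΦ₁' : Nat.totient 7 = 6 := Nat.totient_prime (by norm_num)
    rw [hΦ₁'] at hB2 ⊢
    left
    by_cases hqb11 : q ^ b = 11
    · -- `A = 0` (`7⁵ ≡ −1 (11)`)
      have hq11' : q = 11 := (Nat.prime_dvd_prime_iff_eq hq.out (by norm_num)).1 (hqb11 ▸ dvd_pow_self q hb)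
      subst hq11'
      have hA0 : A = 0 := card_side_eq_zero_of_pow_natCast_eq_neg_one hq2 hb copr1 seven_pow_five_mod_eleven
      rw [hA0, zero_add]
      omega
    · -- `Φ₂ ≥ 12`
      have hΦ₂12 : 12 ≤ (q ^ b).totient := by
        rcases Nat.lt_or_ge b 2 with hb1 | hb2
        · have hb1' : b = 1 := by omega
          subst hb1'
          rw [pow_one] at hqb11 ⊢
          rw [Nat.totient_prime hq.out]
          have hq12 : q ≠ 12 := by
            rintro rfl
            exact absurd hq.out (by decide)
          omega
        · have h110 : 11 * (11 - 1) ≤ q * (q - 1) := Nat.mul_le_mul hq11 (by omega)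
          exact le_trans (by omega) (hΦ₂ge' hb2)
      omega
  · -- `p ≥ 11`: `Φ₁ ≥ 10 ≥ 8`, contradiction
    exfalso
    have : 10 ≤ Nat.totient p := by rw [Nat.totient_prime hp.out]; omega
    omega

end Arithmetic

/-! ## §3 `40·#S₀(N) ≤ 3·φ(N)` at every two-prime level, with `<` iff `N ≠ 55` -/

section TwoPrimes

/-- Transport of the side count along an equality of moduli (private copy of the siblings'). [folklore] -/
private theorem card_level_congr'' (r : ℕ) {M M' : ℕ} (h : M = M') :
    Nat.card {ψ : DirichletCharacter ℂ M // ψ.Odd ∧ ψ (r : ZMod M) = 1} =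
      Nat.card {ψ : DirichletCharacter ℂ M' // ψ.Odd ∧ ψ (r : ZMod M') = 1} := by
  subst h
  rfl

/-- **`40·(A + B) ≤ 3·Φ₁Φ₂` for ALL distinct primes `p, q ≥ 5`** (the sides bound with the constant `3/20`; at `(pᵃ, qᵇ) = (5, 11)` the two
sides are `A(5; 11) = 1`, `A(11; 5) = 2` and equality `120 = 120` holds). [cite: KoblitzRohrlich1978, §2 Case 1 (p. 1191) and Remark 1 (p. 1192)] -/
theorem forty_mul_card_sides_le {p q a b : ℕ} [hp : Fact p.Prime] [hq : Fact q.Prime] (hp5 : 5 ≤ p) (hq5 : 5 ≤ q) (hpq : p ≠ q)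
    (ha : a ≠ 0) (hb : b ≠ 0) :
    40 * (Nat.card {ψ : DirichletCharacter ℂ (q ^ b) // ψ.Odd ∧ ψ (p : ZMod (q ^ b)) = 1} +
        Nat.card {ψ : DirichletCharacter ℂ (p ^ a) // ψ.Odd ∧ ψ (q : ZMod (p ^ a)) = 1}) ≤
      3 * ((p ^ a).totient * (q ^ b).totient) := by
  -- the one equality case, in both orders
  have key : ∀ {p q a b : ℕ} [Fact p.Prime] [Fact q.Prime], p = 5 → a = 1 → q ^ b = 11 →
      40 * (Nat.card {ψ : DirichletCharacter ℂ (q ^ b) // ψ.Odd ∧ ψ (p : ZMod (q ^ b)) = 1} +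
          Nat.card {ψ : DirichletCharacter ℂ (p ^ a) // ψ.Odd ∧ ψ (q : ZMod (p ^ a)) = 1}) ≤
        3 * ((p ^ a).totient * (q ^ b).totient) := by
    intro p q a b _ hq' hp ha hqb
    subst hp ha
    have hb : b ≠ 0 := by
      rintro rfl
      norm_num at hqb
    have hq11 : q = 11 := (Nat.prime_dvd_prime_iff_eq hq'.out (by norm_num)).1 (hqb ▸ dvd_pow_self q hb)
    subst hq11
    rw [card_level_congr'' 5 hqb, card_level_congr'' 11 (pow_one 5), hqb, pow_one, card_side_five_mod_eleven,
      card_side_eleven_mod_five, Nat.totient_prime (by norm_num), Nat.totient_prime (by norm_num)]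
  rcases lt_or_gt_of_ne hpq with h | h
  · rcases forty_mul_card_sides_lt_or_of_lt hp5 h ha hb with hlt | ⟨hp', ha', hqb⟩
    · exact hlt.le
    · exact key hp' ha' hqb
  · rw [add_comm, mul_comm ((p ^ a).totient)]
    rcases forty_mul_card_sides_lt_or_of_lt hq5 h hb ha with hlt | ⟨hq', hb', hpa⟩
    · exact hlt.le
    · exact key hq' hb' hpa

/-- **Strict form away from `55`**: `40·(A + B) < 3·Φ₁Φ₂` unless `{pᵃ, qᵇ} = {5, 11}`. [cite: KoblitzRohrlich1978, §2 Case 1 (p. 1191) and Remark 1 (p. 1192)] -/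
theorem forty_mul_card_sides_lt {p q a b : ℕ} [hp : Fact p.Prime] [hq : Fact q.Prime] (hp5 : 5 ≤ p) (hq5 : 5 ≤ q) (hpq : p ≠ q)
    (ha : a ≠ 0) (hb : b ≠ 0) (h55 : p ^ a * q ^ b ≠ 55) :
    40 * (Nat.card {ψ : DirichletCharacter ℂ (q ^ b) // ψ.Odd ∧ ψ (p : ZMod (q ^ b)) = 1} +
        Nat.card {ψ : DirichletCharacter ℂ (p ^ a) // ψ.Odd ∧ ψ (q : ZMod (p ^ a)) = 1}) <
      3 * ((p ^ a).totient * (q ^ b).totient) := by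
  rcases lt_or_gt_of_ne hpq with h | h
  · rcases forty_mul_card_sides_lt_or_of_lt hp5 h ha hb with hlt | ⟨hp', ha', hqb⟩
    · exact hlt
    · exfalso
      subst hp' ha'
      rw [pow_one, hqb] at h55
      exact h55 rfl
  · rw [add_comm, mul_comm ((p ^ a).totient)]
    rcases forty_mul_card_sides_lt_or_of_lt hq5 h hb ha with hlt | ⟨hq', hb', hpa⟩
    · exact hlt
    · exfalso
      subst hq' hb'
      rw [pow_one, hpa] at h55
      exact h55 rfl

variable {p q a b N : ℕ} [hp : Fact p.Prime] [hq : Fact q.Prime] [NeZero N]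

/-- **REMARK 1 "`3/20` is the maximum for `s(N)`" at two-prime levels, integer form**: for `N = pᵃqᵇ` (`p ≠ q` primes `≥ 5`, `a, b ≥ 1`),
`40·#S₀(N) ≤ 3·φ(N)` (with `#S(N) = φ(N)/2`: `#S₀(N)/#S(N) ≤ 3/20`). [cite: KoblitzRohrlich1978, §2 Remark 1 (p. 1192)] -/
theorem forty_mul_card_bad_le_twoPrimes (hp5 : 5 ≤ p) (hq5 : 5 ≤ q) (hpq : p ≠ q) (ha : a ≠ 0) (hb : b ≠ 0) (hN : N = p ^ a * q ^ b) :
    40 * Nat.card {χ : DirichletCharacter ℂ N // χ.Odd ∧ bernoulliOneChar χ = 0} ≤ 3 * N.totient := by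
  have hcop : (p ^ a).Coprime (q ^ b) := (((Nat.coprime_primes hp.out hq.out).2 hpq).pow_right b).pow_left a
  rw [card_bad_eq_card_sides_twoPrimes hpq ha hb hN, hN, Nat.totient_mul hcop]
  exact forty_mul_card_sides_le hp5 hq5 hpq ha hb

/-- **The maximum is attained ONLY at `55`**: for `N = pᵃqᵇ ≠ 55`, `40·#S₀(N) < 3·φ(N)` (`s(N) < 3/20`). [cite: KoblitzRohrlich1978, §2 Case 1 (p. 1191) and Remark 1 (p. 1192)] -/
theorem forty_mul_card_bad_lt_twoPrimes (hp5 : 5 ≤ p) (hq5 : 5 ≤ q) (hpq : p ≠ q) (ha : a ≠ 0) (hb : b ≠ 0) (hN : N = p ^ a * q ^ b)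
    (h55 : N ≠ 55) :
    40 * Nat.card {χ : DirichletCharacter ℂ N // χ.Odd ∧ bernoulliOneChar χ = 0} < 3 * N.totient := by
  have hcop : (p ^ a).Coprime (q ^ b) := (((Nat.coprime_primes hp.out hq.out).2 hpq).pow_right b).pow_left a
  rw [card_bad_eq_card_sides_twoPrimes hpq ha hb hN, hN, Nat.totient_mul hcop]
  exact forty_mul_card_sides_lt hp5 hq5 hpq ha hb (hN ▸ h55)

/-- **At `N = 55` equality holds**: `40·#S₀(55) = 120 = 3·φ(55)` (the sibling's `#S₀(55) = 3`). [cite: KoblitzRohrlich1978, §2 Remark 1 (p. 1192)] -/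
theorem forty_mul_card_bad_fiftyFive_eq :
    40 * Nat.card {χ : DirichletCharacter ℂ 55 // χ.Odd ∧ bernoulliOneChar χ = 0} = 3 * Nat.totient 55 := by
  rw [card_bad_fiftyFive, show (55 : ℕ) = 5 * 11 from rfl, Nat.totient_mul (by norm_num), Nat.totient_prime (by norm_num),
    Nat.totient_prime (by norm_num)]

/-- **`s(N) < 3/20` iff `N ≠ 55`, at two-prime levels.** [cite: KoblitzRohrlich1978, §2 Remark 1 (p. 1192)] -/
theorem forty_mul_card_bad_lt_iff_twoPrimes (hp5 : 5 ≤ p) (hq5 : 5 ≤ q) (hpq : p ≠ q) (ha : a ≠ 0) (hb : b ≠ 0)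
    (hN : N = p ^ a * q ^ b) :
    40 * Nat.card {χ : DirichletCharacter ℂ N // χ.Odd ∧ bernoulliOneChar χ = 0} < 3 * N.totient ↔ N ≠ 55 := by
  constructor
  · rintro h rfl
    rw [forty_mul_card_bad_fiftyFive_eq] at h
    exact lt_irrefl _ h
  · exact forty_mul_card_bad_lt_twoPrimes hp5 hq5 hpq ha hb hN

end TwoPrimes

/-! ## §4 The printed form: `s(N) ≤ 3/20 = s(55)` -/

section Printed

variable {p q a b N : ℕ} [hp : Fact p.Prime] [hq : Fact q.Prime] [NeZero N]

/-- **"`3/20` is the maximum for `s(N)`" at two-prime levels**: `s(N) = #S₀(N)/#S(N) ≤ 3/20` for `N = pᵃqᵇ` (`p ≠ q` primes `≥ 5`).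
[cite: KoblitzRohrlich1978, §2 Remark 1 (p. 1192)] -/
theorem s_le_three_div_twenty_twoPrimes (hp5 : 5 ≤ p) (hq5 : 5 ≤ q) (hpq : p ≠ q) (ha : a ≠ 0) (hb : b ≠ 0)
    (hN : N = p ^ a * q ^ b) :
    (Nat.card {χ : DirichletCharacter ℂ N // χ.Odd ∧ bernoulliOneChar χ = 0} : ℚ) /
        Nat.card {χ : DirichletCharacter ℂ N // χ.Odd} ≤ 3 / 20 := by
  have hN2 : 2 < N := by
    rw [hN]
    calc 2 < 5 := by norm_num
      _ ≤ p := hp5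
      _ = p ^ 1 := (pow_one p).symm
      _ ≤ p ^ a := Nat.pow_le_pow_right (by omega) (Nat.one_le_iff_ne_zero.2 ha)
      _ ≤ p ^ a * q ^ b := Nat.le_mul_of_pos_right _ (pow_pos hq.out.pos b)
  have hS := two_mul_card_odd_eq_totient' (M := N) hN2
  have h := forty_mul_card_bad_le_twoPrimes hp5 hq5 hpq ha hb hN
  have hSpos : 0 < Nat.card {χ : DirichletCharacter ℂ N // χ.Odd} := by
    have := Nat.totient_pos.2 (NeZero.pos N)
    omega
  rw [div_le_div_iff₀ (by exact_mod_cast hSpos) (by norm_num)]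
  have h' : (40 : ℚ) * Nat.card {χ : DirichletCharacter ℂ N // χ.Odd ∧ bernoulliOneChar χ = 0} ≤
      3 * (2 * Nat.card {χ : DirichletCharacter ℂ N // χ.Odd}) := by
    rw [show (3 : ℚ) * (2 * Nat.card {χ : DirichletCharacter ℂ N // χ.Odd}) = 3 * ((2 * Nat.card {χ : DirichletCharacter ℂ N // χ.Odd} : ℕ) : ℚ)
      by push_cast; ring, hS]
    exact_mod_cast h
  linarith

/-- **`s(N) ≤ s(55)`**: at every two-prime level `N = pᵃqᵇ` (`p ≠ q` primes `≥ 5`) the ratio `#S₀(N)/#S(N)` is at most its value `3/20` at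
`N = 55` ("It is clear from the above proof that `3/20` is the maximum for `s(N)`" — here for `ω(N) = 2`; for prime powers `s = 0`, §1).
[cite: KoblitzRohrlich1978, §2 Remark 1 (p. 1192)] -/
theorem s_le_s_fiftyFive_twoPrimes (hp5 : 5 ≤ p) (hq5 : 5 ≤ q) (hpq : p ≠ q) (ha : a ≠ 0) (hb : b ≠ 0) (hN : N = p ^ a * q ^ b) :
    (Nat.card {χ : DirichletCharacter ℂ N // χ.Odd ∧ bernoulliOneChar χ = 0} : ℚ) /
        Nat.card {χ : DirichletCharacter ℂ N // χ.Odd} ≤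
      (Nat.card {χ : DirichletCharacter ℂ 55 // χ.Odd ∧ bernoulliOneChar χ = 0} : ℚ) /
        Nat.card {χ : DirichletCharacter ℂ 55 // χ.Odd} := by
  rw [s_fiftyFive]
  exact s_le_three_div_twenty_twoPrimes hp5 hq5 hpq ha hb hN

/-- **Prime powers: `s(pⁿ) = 0 ≤ 3/20`.** [cite: KoblitzRohrlich1978, §2 (p. 1188) and Remark 1 (p. 1192)] -/
theorem s_primePow_eq_zero {n : ℕ} [NeZero (p ^ n)] :
    (Nat.card {χ : DirichletCharacter ℂ (p ^ n) // χ.Odd ∧ bernoulliOneChar χ = 0} : ℚ) /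
        Nat.card {χ : DirichletCharacter ℂ (p ^ n) // χ.Odd} = 0 := by
  rw [card_bad_primePow_eq_zero, Nat.cast_zero, zero_div]

end Printed

end CyclotomicFermatCMType

end Literature.AlgebraicGeometry.ComplexMultiplication
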